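import Mathlib.GroupTheory.Perm.Cycle.Type
import Mathlib.GroupTheory.Perm.List
import Mathlib.NumberTheory.Bertrand
import Mathlib.Dynamics.PeriodicPts.Defs
import Literature.Computability.Complexity.CircuitReduce
import Literature.Computability.Complexity.SymmetricCircuit
import Literature.Combinatorics.SimpleGraph.HamiltonianCycleListings
import HarnessLib

/-!
# Symmetric circuits of fan-in two are blind to the free vertices

A structural limitation of SYMMETRIC Boolean circuits (Anderson–Dawar automorphism condition,
`Circuit.IsSymmetricUnder`, `GateDAG.IsAut`) over bases of SYMMETRIC gate functions of fan-in at
most two (e.g. `{∧₂, ∨₂, ¬}`), explaining why the symmetric-circuit literature works with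
unbounded fan-in threshold/majority bases (Anderson–Dawar 2017, §2; Dawar–Wilsenach 2025, §3):

* `GateDAG.IsAut.rel_args_eq_of_cube` — **order three beats fan-in two**: in a RIGID DAG, if the
  automorphism `θ` over an input map `π` with `π³ = id` fixes a gate of fan-in `≤ 2`, then the
  relabelling `π ⊕ θ` fixes each child wire of that gate (it is an involution on the `≤ 2`
  children, `GateDAG.apply_apply_eq_of_perm_map`, and `θ³` is the automorphism over `π³ = id`,
  i.e. the identity, by rigidity);
* `GateDAG.val_eq_of_fixed`, `GateDAG.evalOut_eq_of_fixed` — hence, by induction down the DAG,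
  the output of a rigid DAG of fan-in `≤ 2` depends only on the input positions fixed by all the
  order-three input maps carried by automorphisms;
* `Circuit.eval_eq_of_fanIn_two`, `Circuit.eval_eq_of_fanIn_two_of_agree` — for straight-line
  circuits on `m × m` matrices symmetric under the point-stabiliser budget
  `pointStabiliserBudget m g` (the last `g` vertices free), NOT necessarily rigid: pass to the
  reduced circuit (`GateDAG.reduce`, Anderson–Dawar Lemma 7 as formalised in `CircuitReduce.lean`,
  which keeps fan-in, symmetry and values and is rigid) and use the three-cycles of free vertices
  (`exists_threeCycle_moving`, `3 ≤ g ≤ m`): such a circuit has the same value on any two matrices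
  that agree on the ORDERED block `{(u, v) : u + g < m ∧ v + g < m}`;
* `Circuit.not_computes_ham_of_fanIn_two`, `Circuit.not_hasSymCircuit_deMorgan_ham` — in
  particular no such circuit, of any size, computes Hamiltonicity (the all-ones matrix and the
  matrix isolating a free vertex agree on the ordered block); over `{∧₂, ∨₂, ¬}` no
  `Bud(m, ⌊log₂ m⌋)`-symmetric circuit computes `HAM_m` for `m ≥ 8`;
* `Circuit.eval_eq_of_fanIn_two_univ` — with FULL symmetry (`m ≥ 3`) such circuits compute
  constants;
* `GateDAG.apply_eq_of_perm_map_of_prime`, `GateDAG.IsAut.rel_args_eq_of_prime`,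
  `Circuit.eval_eq_of_fanIn_lt_prime_of_agree` — the same with "fan-in `≤ 2` / three-cycles"
  replaced by "fan-in `< p` / elements of order `p`" for any prime `p ≤ g` (the `r`-orbit of a
  child stays among the `< p` children and has size `1` or `p`; `p`-cycles of free vertices via
  `List.formPerm`); hence `Circuit.exists_gate_arity_ge_prime_of_computes_ham` and, by Bertrand's
  postulate, `Circuit.exists_gate_arity_gt_half_log_of_computes_ham`: **a window-symmetric
  threshold circuit for `HAM_m` has a gate of fan-in `> ⌊log₂ m⌋ / 2`** (`m ≥ 8`).

For the route `PneNP/SymmetryBudget` this says that the unbounded fan-in of `tcBasis` is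
load-bearing: with a fan-in-2 basis the conclusion of crux `HamCompiles` is false outright and
crux `WindowHam` is trivially true (recorded in the crux work files). With FULL symmetry
(`g = m ≥ 3`) the statement reads: a `Sym(m)`-symmetric fan-in-2 circuit with symmetric gates
computes a constant. We have not found this elementary observation stated in print; it is tagged
folklore. Everything is proved; no named facts. Deliberately NOT here: the sharp threshold
"fan-in `< g`" (which needs the minimal index of proper subgroups of `A_g` instead of elements of
prime order), and non-symmetric gate functions (for which the multiset automorphism condition is
not the natural one).

## References

* M. Anderson, A. Dawar, *On symmetric circuits and fixed-point logics*, Theory Comput. Syst. 60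
  (2017), §2 and Lemma 7 [AndersonDawar2016].
* A. Dawar, G. Wilsenach, *Symmetric circuits for rank logic / lower bounds for symmetric
  circuits*, Theory of Computing 21 (2025), §3 [DawarWilsenach2025].
-/

namespace Literature.Computability.Complexity

namespace GateDAG

variable {ι Λ : Type*}

/-! ### A permutation of a list of length `≤ 2` onto its image is an involution on it -/

/-- If a list of length at most two is a permutation of its image under `r`, then `r ∘ r` fixes
every member. [folklore] -/
theorem apply_apply_eq_of_perm_map {α : Type*} [DecidableEq α] {L : List α} (hL : L.length ≤ 2)
    {r : α → α} (h : L.Perm (L.map r)) : ∀ a ∈ L, r (r a) = a := by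
  rcases L with _ | ⟨a, _ | ⟨b, _ | ⟨c, L⟩⟩⟩
  · intro a ha; simp at ha
  · intro x hx
    simp only [List.map_cons, List.map_nil, List.perm_singleton, List.cons.injEq, and_true] at h
    simp only [List.mem_singleton] at hx
    subst hx
    rw [← h, ← h]
  · -- `[a, b] ~ [r a, r b]`
    have hmem1 : r a ∈ [a, b] := h.symm.subset (by simp)
    have hmem2 : r b ∈ [a, b] := h.symm.subset (by simp)
    have hmem3 : a ∈ [r a, r b] := h.subset (by simp)
    have hmem4 : b ∈ [r a, r b] := h.subset (by simp)
    simp only [List.mem_cons, List.not_mem_nil, or_false] at hmem1 hmem2 hmem3 hmem4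
    intro x hx
    simp only [List.mem_cons, List.not_mem_nil, or_false] at hx
    rcases hx with rfl | rfl
    · rcases hmem1 with h1 | h1
      · rw [h1, h1]
      · rw [h1]
        rcases hmem3 with h3 | h3
        · rw [h1] at h3; rw [← h3, h1, ← h3]
        · exact h3.symm
    · rcases hmem2 with h2 | h2
      · rw [h2]
        rcases hmem4 with h4 | h4
        · exact h4.symm
        · rw [h2] at h4; rw [← h4, h2, ← h4]
      · rw [h2, h2]
  · simp at hL

/-! ### Automorphisms of a rigid DAG along a group of input permutations -/

section Rigid

variable (R : GateDAG ι Λ)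

/-- An automorphism over the identity of a rigid DAG is the identity. [folklore] -/
theorem IsRigidDAG.eq_refl (hR : R.IsRigidDAG) {θ : Λ ≃ Λ} (h : R.IsAut _root_.id θ) :
    θ = Equiv.refl Λ :=
  hR _ _ _ h R.isAut_id_refl

/-- In a rigid DAG, the automorphism over a composite is the composite of the automorphisms.
[folklore] -/
theorem IsRigidDAG.eq_trans (hR : R.IsRigidDAG) {π π' : ι → ι} {θ θ' θ'' : Λ ≃ Λ}
    (h : R.IsAut π θ) (h' : R.IsAut π' θ') (h'' : R.IsAut (π' ∘ π) θ'') :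
    θ'' = θ.trans θ' :=
  hR _ _ _ h'' (IsAut.trans R h h')

variable {R}

/-- The wire relabelling of an automorphism. [folklore] -/
abbrev rel (π : ι → ι) (θ : Λ ≃ Λ) : ι ⊕ Λ → ι ⊕ Λ := Sum.map π θ

/-- For an automorphism FIXING a gate of fan-in `≤ 2`, the relabelling is an involution on the
children of that gate. [folklore] -/
theorem IsAut.rel_rel_args [DecidableEq ι] [DecidableEq Λ] {π : ι → ι} {θ : Λ ≃ Λ}
    (h : R.IsAut π θ) {l : Λ} (hl : θ l = l) (h2 : (R.fn l).1 ≤ 2) (a : Fin (R.fn l).1) :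
    rel π θ (rel π θ (R.args l a)) = R.args l a := by
  have hp := h.args_perm l
  rw [hl] at hp
  exact apply_apply_eq_of_perm_map (by rw [List.length_ofFn]; exact h2) hp _
    (List.mem_ofFn.2 ⟨a, rfl⟩)

/-- **Order three beats fan-in two.** Let `θ₁, θ₂, θ₃` be automorphisms over `π, π ∘ π, π ∘ π ∘ π`
of a rigid DAG, with `π ∘ π ∘ π = id` (so `θ₃ = 1`). If `θ₁` fixes a gate `l` of fan-in `≤ 2`, then
the relabelling `rel π θ₁` fixes every child wire of `l`: it is an involution on the children and
has order dividing three. [folklore] -/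
theorem IsAut.rel_args_eq_of_cube [DecidableEq ι] [DecidableEq Λ] (hR : R.IsRigidDAG)
    {π : ι → ι} (hπ : π ∘ π ∘ π = _root_.id) {θ : Λ ≃ Λ} (h : R.IsAut π θ)
    {l : Λ} (hl : θ l = l) (h2 : (R.fn l).1 ≤ 2) (a : Fin (R.fn l).1) :
    rel π θ (R.args l a) = R.args l a := by
  -- `θ ∘ θ ∘ θ` is the automorphism over `π ∘ π ∘ π = id`, hence the identity
  have h3 : R.IsAut (π ∘ π ∘ π) ((θ.trans θ).trans θ) :=
    IsAut.trans R (IsAut.trans R h h) h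
  rw [hπ] at h3
  have hid : (θ.trans θ).trans θ = Equiv.refl Λ := IsRigidDAG.eq_refl R hR h3
  have hrel3 : ∀ w : ι ⊕ Λ, rel π θ (rel π θ (rel π θ w)) = w := by
    intro w
    rcases w with i | m
    · show Sum.inl (π (π (π i))) = Sum.inl i
      have := congrFun hπ i
      simp only [Function.comp_apply, id_eq] at this
      rw [this]
    · show Sum.inr (θ (θ (θ m))) = Sum.inr m
      have := congrArg (fun e : Λ ≃ Λ => e m) hid
      simpa using this
  have hinv := h.rel_rel_args hl h2 a
  -- `w = r³ w = r (r² w) = r w`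
  calc rel π θ (R.args l a) = rel π θ (rel π θ (rel π θ (R.args l a))) := by rw [hinv]
    _ = R.args l a := hrel3 _

end Rigid

/-! ### Blindness: values of gates fixed by the order-three automorphisms -/

section Blind

variable {R : GateDAG ι Λ}

/-- **Induction down a rigid DAG of fan-in `≤ 2`.** Let `P` be a set of input maps `π` with
`π³ = id`, each carried by an automorphism `θ_π`. If two inputs `x, y` agree at every input
position fixed by all `π ∈ P`, then every gate fixed by all `θ_π` has the same value on `x` and
`y` (its children are again fixed, by `rel_args_eq_of_cube`). [folklore] -/
theorem val_eq_of_fixed [DecidableEq ι] [DecidableEq Λ] (hR : R.IsRigidDAG)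
    (h2 : ∀ l, (R.fn l).1 ≤ 2) {P : Set (ι → ι)} (hP : ∀ π ∈ P, π ∘ π ∘ π = _root_.id)
    (θ : ∀ π ∈ P, Λ ≃ Λ) (hθ : ∀ π (hπ : π ∈ P), R.IsAut π (θ π hπ))
    {x y : ι → Bool} (hxy : ∀ i, (∀ π ∈ P, π i = i) → x i = y i) :
    ∀ l, (∀ π (hπ : π ∈ P), θ π hπ l = l) → R.val x l = R.val y l := by
  intro l
  induction l using R.wf.induction with
  | _ l ih =>
    intro hfix
    rw [R.val_eq, R.val_eq]
    refine congrArg (R.fn l).2 (funext fun a => ?_)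
    have hchild : ∀ π (hπ : π ∈ P), rel π (θ π hπ) (R.args l a) = R.args l a :=
      fun π hπ => (hθ π hπ).rel_args_eq_of_cube hR (hP π hπ) (hfix π hπ) (h2 l) a
    cases ha : R.args l a with
    | inl i =>
      simp only [wire_inl]
      refine hxy i fun π hπ => ?_
      have := hchild π hπ
      rw [ha] at this
      exact Sum.inl.inj this
    | inr m =>
      simp only [wire_inr]
      refine ih m ⟨a, ha⟩ fun π hπ => ?_
      have := hchild π hπ
      rw [ha] at this
      exact Sum.inr.inj this

/-- **Blindness of the output.** Under the hypotheses of `val_eq_of_fixed`, if moreover the output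
wire is fixed by every `θ_π` / `π` (as it is for automorphisms), the DAG has the same output on `x`
and `y`. [folklore] -/
theorem evalOut_eq_of_fixed [DecidableEq ι] [DecidableEq Λ] (hR : R.IsRigidDAG)
    (h2 : ∀ l, (R.fn l).1 ≤ 2) {P : Set (ι → ι)} (hP : ∀ π ∈ P, π ∘ π ∘ π = _root_.id)
    (θ : ∀ π ∈ P, Λ ≃ Λ) (hθ : ∀ π (hπ : π ∈ P), R.IsAut π (θ π hπ))
    {x y : ι → Bool} (hxy : ∀ i, (∀ π ∈ P, π i = i) → x i = y i) :
    R.evalOut x = R.evalOut y := by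
  unfold evalOut
  cases ho : R.out with
  | inl i =>
    simp only [wire_inl]
    refine hxy i fun π hπ => ?_
    have := (hθ π hπ).out_eq
    rw [ho] at this
    exact Sum.inl.inj this
  | inr l =>
    simp only [wire_inr]
    refine val_eq_of_fixed hR h2 hP θ hθ hxy l fun π hπ => ?_
    have := (hθ π hπ).out_eq
    rw [ho] at this
    exact Sum.inr.inj this

end Blind

end GateDAG

/-! ### Matrix circuits symmetric under the point-stabiliser budget -/

section Matrix

open GateDAG

variable {m : ℕ}

/-- The diagonal action of a vertex permutation on matrix positions. [folklore] -/
def diagMap (ρ : Equiv.Perm (Fin m)) : Fin m × Fin m → Fin m × Fin m := fun q => (ρ q.1, ρ q.2)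

/-- `diagMap` of a permutation of order dividing three cubes to the identity. [folklore] -/
theorem diagMap_comp_three {ρ : Equiv.Perm (Fin m)} (h : ρ ^ 3 = 1) :
    diagMap ρ ∘ diagMap ρ ∘ diagMap ρ = _root_.id := by
  funext q
  have h' : ∀ i, ρ (ρ (ρ i)) = i := fun i => by
    have := congrArg (fun e : Equiv.Perm (Fin m) => e i) h
    simpa [pow_succ, Equiv.Perm.mul_apply] using this
  simp only [Function.comp_apply, diagMap, id_eq, h']

/-- **Fan-in two symmetric circuits see only budget-fixed positions.** Let `C` be a circuit on
`m × m` matrices whose gates are SYMMETRIC gate functions of fan-in `≤ 2`, symmetric under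
`Bud(m,g)` (Anderson–Dawar automorphisms, not necessarily rigid). If two matrices agree at every
position `(u, v)` with `u, v` fixed by all elements of order dividing `3` of `Bud(m,g)`, then `C`
has the same value on them. Proof: pass to the reduced (rigid) circuit, where every gate below the
output is fixed by the automorphism of every such element (order three versus an involution on at
most two children), so the output reads only fixed positions. [folklore] -/
theorem Circuit.eval_eq_of_fanIn_two {g : ℕ} (C : Circuit (Fin m × Fin m))
    (h2 : ∀ gt ∈ C.gates, gt.arity ≤ 2) (hsym : ∀ gt ∈ C.gates, gt.fn.IsSymmetric)
    (hS : C.IsSymmetricUnder (pointStabiliserBudget m g)) {x y : Fin m × Fin m → Bool}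
    (hxy : ∀ u v : Fin m,
      (∀ ρ ∈ pointStabiliserBudget m g, ρ ^ 3 = 1 → ρ u = u ∧ ρ v = v) → x (u, v) = y (u, v)) :
    C.eval x = C.eval y := by
  classical
  let D := GateDAG.ofCircuit C
  have hfs : ∀ l, (D.fn l).IsSymmetric := fun l => hsym _ (List.getElem_mem _)
  have hDs : D.IsSymm (GateDAG.diagMaps (pointStabiliserBudget m g)) :=
    (GateDAG.isSymmetricUnder_iff_ofCircuit C _).1 hS
  let R := D.reduce
  have hR : R.IsRigidDAG := D.isRigidDAG_reduce
  have hR2 : ∀ l, (R.fn l).1 ≤ 2 := by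
    rintro (q | c)
    · show (D.fn q.out.1).1 ≤ 2
      exact h2 _ (List.getElem_mem _)
    · show 1 ≤ 2
      omega
  have hdiag : ∀ ρ : Equiv.Perm (Fin m),
      (⇑(Equiv.prodCongr ρ ρ) : Fin m × Fin m → Fin m × Fin m) = diagMap ρ :=
    fun ρ => funext fun q => rfl
  -- every budget element is carried by an automorphism of the reduced circuit
  have hAut : ∀ ρ ∈ pointStabiliserBudget m g, ∃ θ : D.RGate ≃ D.RGate, R.IsAut (diagMap ρ) θ := by
    intro ρ hρ
    obtain ⟨θ, hθ⟩ := hDs _ (GateDAG.diag_mem_diagMaps hρ)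
    have hθ' : D.IsAut (⇑(Equiv.prodCongr ρ ρ)) θ := by rw [hdiag]; exact hθ
    exact ⟨_, by have := hθ'.reduce; rwa [hdiag] at this⟩
  -- the order-three elements of the budget, as diagonal maps
  let P : Set (Fin m × Fin m → Fin m × Fin m) :=
    {π | ∃ ρ ∈ pointStabiliserBudget m g, ρ ^ 3 = 1 ∧ π = diagMap ρ}
  have hP : ∀ π ∈ P, π ∘ π ∘ π = _root_.id := by
    rintro π ⟨ρ, -, h3, rfl⟩
    exact diagMap_comp_three h3
  have hPaut : ∀ π ∈ P, ∃ θ : D.RGate ≃ D.RGate, R.IsAut π θ := by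
    rintro π ⟨ρ, hρ, -, rfl⟩
    exact hAut ρ hρ
  choose θ hθ using hPaut
  have hxy' : ∀ i : Fin m × Fin m, (∀ π ∈ P, π i = i) → x i = y i := by
    rintro ⟨u, v⟩ hi
    refine hxy u v fun ρ hρ h3 => ?_
    have := hi (diagMap ρ) ⟨ρ, hρ, h3, rfl⟩
    simp only [diagMap, Prod.mk.injEq] at this
    exact this
  have key := GateDAG.evalOut_eq_of_fixed hR hR2 hP θ hθ hxy'
  rw [← GateDAG.evalOut_ofCircuit C x, ← GateDAG.evalOut_ofCircuit C y,
    ← GateDAG.evalOut_reduce _ hfs x, ← GateDAG.evalOut_reduce _ hfs y]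
  exact key

end Matrix

/-! ### Free vertices are moved by three-cycles of the budget -/

section Free

variable {m : ℕ}

/-- A permutation moving only free vertices lies in the budget. [folklore] -/
theorem swap_mul_swap_mem_budget {g : ℕ} {a b c : Fin m} (ha : m ≤ (a : ℕ) + g)
    (hb : m ≤ (b : ℕ) + g) (hc : m ≤ (c : ℕ) + g) :
    Equiv.swap a b * Equiv.swap a c ∈ pointStabiliserBudget m g := by
  rw [mem_pointStabiliserBudget_iff]
  intro i hi
  have hia : i ≠ a := fun h => by subst h; omega
  have hib : i ≠ b := fun h => by subst h; omega
  have hic : i ≠ c := fun h => by subst h; omega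
  rw [Equiv.Perm.mul_apply, Equiv.swap_apply_of_ne_of_ne hia hic, Equiv.swap_apply_of_ne_of_ne hia hib]

/-- **Every free vertex is moved by an order-three element of the budget** (`3 ≤ g ≤ m`: there are
three free vertices). [folklore] -/
theorem exists_threeCycle_moving {g : ℕ} (hg : 3 ≤ g) (hgm : g ≤ m) {u : Fin m}
    (hu : m ≤ (u : ℕ) + g) :
    ∃ ρ ∈ pointStabiliserBudget m g, ρ ^ 3 = 1 ∧ ρ u ≠ u := by
  -- three distinct free vertices `m-1, m-2, m-3`; two of them differ from `u`
  have hm : 3 ≤ m := hg.trans hgm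
  obtain ⟨b, c, hb, hc, hub, huc, hbc⟩ : ∃ b c : Fin m, m ≤ (b : ℕ) + g ∧ m ≤ (c : ℕ) + g ∧
      u ≠ b ∧ u ≠ c ∧ b ≠ c := by
    let p : Fin m := ⟨m - 1, by omega⟩
    let q : Fin m := ⟨m - 2, by omega⟩
    let r : Fin m := ⟨m - 3, by omega⟩
    have hp : m ≤ (p : ℕ) + g := by show m ≤ m - 1 + g; omega
    have hq : m ≤ (q : ℕ) + g := by show m ≤ m - 2 + g; omega
    have hr : m ≤ (r : ℕ) + g := by show m ≤ m - 3 + g; omega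
    have hpq : p ≠ q := fun h => by have := congrArg Fin.val h; simp [p, q] at this; omega
    have hpr : p ≠ r := fun h => by have := congrArg Fin.val h; simp [p, r] at this; omega
    have hqr : q ≠ r := fun h => by have := congrArg Fin.val h; simp [q, r] at this; omega
    by_cases h1 : u = p
    · exact ⟨q, r, hq, hr, by rw [h1]; exact hpq, by rw [h1]; exact hpr, hqr⟩
    · by_cases h2 : u = q
      · exact ⟨p, r, hp, hr, by rw [h2]; exact hpq.symm, by rw [h2]; exact hqr, hpr⟩
      · exact ⟨p, q, hp, hq, h1, h2, hpq⟩
  refine ⟨Equiv.swap u b * Equiv.swap u c, swap_mul_swap_mem_budget hu hb hc, ?_, ?_⟩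
  · have h3 := (Equiv.Perm.isThreeCycle_swap_mul_swap_same hub huc hbc).orderOf
    rw [← h3]
    exact pow_orderOf_eq_one _
  · rw [Equiv.Perm.mul_apply, Equiv.swap_apply_left, Equiv.swap_apply_of_ne_of_ne huc.symm hbc.symm]
    exact huc.symm

/-- **Fan-in two symmetric circuits are blind to the free vertices.** For `3 ≤ g ≤ m`, a
`Bud(m,g)`-symmetric circuit with symmetric gates of fan-in `≤ 2` has the same value on any two
matrices that agree on the ORDERED block `{(u,v) : u + g < m, v + g < m}`. [folklore] -/
theorem Circuit.eval_eq_of_fanIn_two_of_agree {g : ℕ} (hg : 3 ≤ g) (hgm : g ≤ m)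
    (C : Circuit (Fin m × Fin m))
    (h2 : ∀ gt ∈ C.gates, gt.arity ≤ 2) (hsym : ∀ gt ∈ C.gates, gt.fn.IsSymmetric)
    (hS : C.IsSymmetricUnder (pointStabiliserBudget m g)) {x y : Fin m × Fin m → Bool}
    (hxy : ∀ u v : Fin m, (u : ℕ) + g < m → (v : ℕ) + g < m → x (u, v) = y (u, v)) :
    C.eval x = C.eval y := by
  refine C.eval_eq_of_fanIn_two h2 hsym hS fun u v huv => hxy u v ?_ ?_
  · by_contra hu
    obtain ⟨ρ, hρ, h3, hne⟩ := exists_threeCycle_moving hg hgm (u := u) (by omega)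
    exact hne (huv ρ hρ h3).1
  · by_contra hv
    obtain ⟨ρ, hρ, h3, hne⟩ := exists_threeCycle_moving hg hgm (u := v) (by omega)
    exact hne (huv ρ hρ h3).2

/-- **Fully symmetric fan-in two circuits compute constants** (`m ≥ 3`): a `Sym(Fin m)`-symmetric
circuit on `m × m` matrices with symmetric gates of fan-in `≤ 2` has the same value on all inputs.
[folklore] -/
theorem Circuit.eval_eq_of_fanIn_two_univ (hm : 3 ≤ m) (C : Circuit (Fin m × Fin m))
    (h2 : ∀ gt ∈ C.gates, gt.arity ≤ 2) (hsym : ∀ gt ∈ C.gates, gt.fn.IsSymmetric)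
    (hS : C.IsSymmetricUnder Set.univ) (x y : Fin m × Fin m → Bool) : C.eval x = C.eval y := by
  rw [← pointStabiliserBudget_of_le (le_refl m)] at hS
  exact C.eval_eq_of_fanIn_two_of_agree hm le_rfl h2 hsym hS fun u v hu _ => absurd hu (by omega)

end Free

/-! ### Hamiltonicity is not computed by fan-in two symmetric circuits -/

section Ham

open Literature.Combinatorics.SimpleGraph

variable {m : ℕ}

/-- The complete graph on `Fin m`, `m ≥ 3`, read off the all-ones matrix, is Hamiltonian
(listing `0, 1, …, m-1`). [folklore] -/
theorem isHamiltonian_fromRel_true (hm : 3 ≤ m) :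
    (SimpleGraph.fromRel fun u v : Fin m => (fun _ : Fin m × Fin m => true) (u, v) = true).IsHamiltonian := by
  have hl : IsHamCycleListing
      (SimpleGraph.fromRel fun u v : Fin m => (fun _ : Fin m × Fin m => true) (u, v) = true).Adj
      (List.finRange m) := by
    refine ⟨List.nodup_finRange m, List.mem_finRange, fun i hi => ?_⟩
    rw [SimpleGraph.fromRel_adj]
    refine ⟨fun h => ?_, Or.inl rfl⟩
    have hv := congrArg Fin.val h
    simp only [List.getElem_finRange, Fin.val_cast, List.length_finRange] at hv
    have hi' : i < m := by simpa using hi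
    by_cases h1 : i + 1 < m
    · rw [Nat.mod_eq_of_lt h1] at hv; omega
    · have : i + 1 = m := by omega
      rw [this, Nat.mod_self] at hv; omega
  exact hl.isHamiltonian (by rw [List.length_finRange]; exact hm)

/-- The matrix of the complete graph with the vertex `w` isolated. [folklore] -/
def isolateMat (w : Fin m) : Fin m × Fin m → Bool := fun q => decide (q.1 ≠ w ∧ q.2 ≠ w)

/-- The graph read off `isolateMat w` has `w` isolated, hence is not Hamiltonian (`m ≥ 3`).
[folklore] -/
theorem not_isHamiltonian_isolateMat (hm : 3 ≤ m) (w : Fin m) :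
    ¬ (SimpleGraph.fromRel fun u v : Fin m => isolateMat w (u, v) = true).IsHamiltonian := by
  intro hH
  have hcard : 3 ≤ Fintype.card (Fin m) := by rw [Fintype.card_fin]; exact hm
  obtain ⟨l, hl⟩ := (isHamiltonian_iff_of_three_le_card _ hcard).1 hH
  obtain ⟨i, hi, hiw⟩ := List.mem_iff_getElem.1 (hl.mem w)
  have hadj := hl.rel i hi
  rw [hiw, SimpleGraph.fromRel_adj] at hadj
  obtain ⟨-, h | h⟩ := hadj
  · simp [isolateMat] at h
  · simp [isolateMat] at h

open scoped Classical in
/-- **No `Bud(m,g)`-symmetric circuit with symmetric gates of fan-in `≤ 2` computes Hamiltonicity**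
(`3 ≤ g ≤ m`), at ANY size: the all-ones matrix and the matrix isolating the free vertex `m - 1`
agree on the ordered block and differ in Hamiltonicity. In particular the conclusions of the
route's cruxes `HamCompiles` / `¬WindowHam` become FALSE outright when the threshold basis is
replaced by a bounded fan-in basis such as `{∧₂, ∨₂, ¬}`: the unbounded fan-in of `tcBasis` is
load-bearing. [folklore] -/
theorem Circuit.not_computes_ham_of_fanIn_two {g : ℕ} (hg : 3 ≤ g) (hgm : g ≤ m)
    (C : Circuit (Fin m × Fin m))
    (h2 : ∀ gt ∈ C.gates, gt.arity ≤ 2) (hsym : ∀ gt ∈ C.gates, gt.fn.IsSymmetric)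
    (hS : C.IsSymmetricUnder (pointStabiliserBudget m g)) :
    ¬ C.Computes (fun x : Fin m × Fin m → Bool =>
        decide (SimpleGraph.fromRel fun u v => x (u, v) = true : SimpleGraph (Fin m)).IsHamiltonian) := by
  intro hC
  have hm : 3 ≤ m := hg.trans hgm
  let w : Fin m := ⟨m - 1, by omega⟩
  have hw : m ≤ (w : ℕ) + g := by show m ≤ m - 1 + g; omega
  have hagree : ∀ u v : Fin m, (u : ℕ) + g < m → (v : ℕ) + g < m →
      true = isolateMat w (u, v) := by
    intro u v hu hv
    have huw : u ≠ w := fun h => by rw [h] at hu; omega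
    have hvw : v ≠ w := fun h => by rw [h] at hv; omega
    simp [isolateMat, huw, hvw]
  have key := C.eval_eq_of_fanIn_two_of_agree hg hgm h2 hsym hS
    (x := fun _ => true) (y := isolateMat w) hagree
  rw [hC, hC] at key
  have h1 := isHamiltonian_fromRel_true hm
  have h0 := not_isHamiltonian_isolateMat hm w
  rw [Bool.eq_iff_iff, decide_eq_true_iff, decide_eq_true_iff] at key
  exact h0 (key.1 h1)

/-- Gates of a `{∧₂, ∨₂, ¬}`-circuit have fan-in `≤ 2`. [folklore] -/
theorem arity_le_two_of_isOver_deMorgan (C : Circuit (Fin m × Fin m)) (hB : C.IsOver deMorganBasis) :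
    ∀ gt ∈ C.gates, gt.arity ≤ 2 := by
  intro gt hgt
  have h := hB gt hgt
  simp only [deMorganBasis, Set.mem_insert_iff, Set.mem_singleton_iff] at h
  rcases h with h | h | h
  · have := congrArg Sigma.fst h; exact le_of_eq this
  · have := congrArg Sigma.fst h; exact le_of_eq this
  · have := congrArg Sigma.fst h
    show gt.fn.1 ≤ 2
    rw [this]; decide

/-- Gates of a `{∧₂, ∨₂, ¬}`-circuit are symmetric gate functions. [folklore] -/
theorem isSymmetric_of_isOver_deMorgan (C : Circuit (Fin m × Fin m)) (hB : C.IsOver deMorganBasis) :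
    ∀ gt ∈ C.gates, gt.fn.IsSymmetric := by
  intro gt hgt
  have h := hB gt hgt
  simp only [deMorganBasis, Set.mem_insert_iff, Set.mem_singleton_iff] at h
  rcases h with h | h | h
  · rw [h]; exact GateFn.isSymmetric_and 2
  · rw [h]; exact GateFn.isSymmetric_or 2
  · rw [h]; exact GateFn.isSymmetric_not

open scoped Classical in
/-- **Over `{∧₂, ∨₂, ¬}` no window-symmetric circuit of any size computes HAM** (`m ≥ 8`, so that
the window `⌊log₂ m⌋ ≥ 3`). [folklore] -/
theorem Circuit.not_hasSymCircuit_deMorgan_ham (hm : 8 ≤ m) (s : ℕ) :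
    ¬ HasSymCircuit deMorganBasis (pointStabiliserBudget m (Nat.log 2 m)) s
      (fun x : Fin m × Fin m → Bool =>
        decide (SimpleGraph.fromRel fun u v => x (u, v) = true : SimpleGraph (Fin m)).IsHamiltonian) := by
  rintro ⟨C, hB, -, hS, hC⟩
  have hg : 3 ≤ Nat.log 2 m := Nat.le_log_of_pow_le (by norm_num) hm
  have hgm : Nat.log 2 m ≤ m := (Nat.log_lt_self 2 (by omega)).le
  exact C.not_computes_ham_of_fanIn_two hg hgm (arity_le_two_of_isOver_deMorgan C hB)
    (isSymmetric_of_isOver_deMorgan C hB) hS hC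

end Ham

/-! ### Generalisation: fan-in below a prime `p` versus input maps of order `p` -/

namespace GateDAG

variable {ι Λ : Type*}

/-- If a list shorter than a prime `p` is a permutation of its image under a map `r` with
`r^[p] = id` on it, then `r` fixes every member (the `r`-orbit of a member stays in the list and
has size `1` or `p`). [folklore] -/
theorem apply_eq_of_perm_map_of_prime {α : Type*} [DecidableEq α] {L : List α} {r : α → α}
    (h : L.Perm (L.map r)) {p : ℕ} (hp : p.Prime) (hL : L.length < p)
    (hr : ∀ a ∈ L, r^[p] a = a) : ∀ a ∈ L, r a = a := by
  intro a ha
  have hcl : ∀ b ∈ L, r b ∈ L := fun b hb => h.symm.subset (List.mem_map.2 ⟨b, hb, rfl⟩)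
  have hit : ∀ n, r^[n] a ∈ L := by
    intro n
    induction n with
    | zero => simpa using ha
    | succ n ih => rw [Function.iterate_succ_apply']; exact hcl _ ih
  have hper : Function.IsPeriodicPt r p a := hr a ha
  rcases (Nat.dvd_prime hp).1 hper.minimalPeriod_dvd with h1 | hpp
  · exact Function.minimalPeriod_eq_one_iff_isFixedPt.1 h1
  · exfalso
    have hinj : Set.InjOn (fun n => r^[n] a) (Set.Iio p) := by
      rw [← hpp]; exact Function.iterate_injOn_Iio_minimalPeriod
    have hcard : (Finset.range p).card ≤ L.toFinset.card := by
      refine Finset.card_le_card_of_injOn (fun n => r^[n] a) (fun n _ => List.mem_toFinset.2 (hit n)) ?_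
      intro n hn n' hn' he
      exact hinj (Set.mem_Iio.2 (Finset.mem_range.1 (Finset.mem_coe.1 hn)))
        (Set.mem_Iio.2 (Finset.mem_range.1 (Finset.mem_coe.1 hn'))) he
    rw [Finset.card_range] at hcard
    have := List.toFinset_card_le L
    omega

section RigidPrime

variable (R : GateDAG ι Λ)

/-- Iterating an automorphism: `θ ^ n` is an automorphism over `π^[n]`. [folklore] -/
theorem IsAut.pow {π : ι → ι} {θ : Λ ≃ Λ} (h : R.IsAut π θ) : ∀ n : ℕ, R.IsAut (π^[n]) (θ ^ n)
  | 0 => by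
    rw [Function.iterate_zero, pow_zero]
    exact R.isAut_id_refl
  | n + 1 => by
    rw [Function.iterate_succ, pow_succ, Equiv.Perm.mul_def]
    exact IsAut.trans R h (IsAut.pow h n)

/-- In a rigid DAG, an automorphism over an input map of order dividing `p` has order dividing `p`.
[folklore] -/
theorem IsAut.pow_eq_one_of_rigid (hR : R.IsRigidDAG) {π : ι → ι} {p : ℕ} (hπ : π^[p] = _root_.id)
    {θ : Λ ≃ Λ} (h : R.IsAut π θ) : θ ^ p = 1 := by
  have hp := IsAut.pow R h p
  rw [hπ] at hp
  exact hR _ _ _ hp R.isAut_id_refl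

variable {R}

/-- Iterates of the wire relabelling. [folklore] -/
theorem rel_iterate (π : ι → ι) (θ : Λ ≃ Λ) (n : ℕ) (w : ι ⊕ Λ) :
    (rel π θ)^[n] w = rel (π^[n]) (θ ^ n) w := by
  induction n generalizing w with
  | zero => rcases w with i | m <;> simp [rel]
  | succ n ih =>
    rw [Function.iterate_succ_apply, ih]
    rcases w with i | m
    · simp [rel]
    · simp only [rel, Sum.map_inr, Sum.inr.injEq]
      rw [pow_succ, Equiv.Perm.mul_apply]

/-- **Prime order beats small fan-in.** In a rigid DAG, if the automorphism `θ` over an input map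
`π` with `π^[p] = id` (`p` prime) fixes a gate of fan-in `< p`, then the relabelling `rel π θ`
fixes every child wire of that gate. [folklore] -/
theorem IsAut.rel_args_eq_of_prime [DecidableEq ι] [DecidableEq Λ] (hR : R.IsRigidDAG)
    {p : ℕ} (hp : p.Prime) {π : ι → ι} (hπ : π^[p] = _root_.id) {θ : Λ ≃ Λ} (h : R.IsAut π θ)
    {l : Λ} (hl : θ l = l) (hlt : (R.fn l).1 < p) (a : Fin (R.fn l).1) :
    rel π θ (R.args l a) = R.args l a := by
  have hθp : θ ^ p = 1 := IsAut.pow_eq_one_of_rigid R hR hπ h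
  have hperm := h.args_perm l
  rw [hl] at hperm
  refine apply_eq_of_perm_map_of_prime hperm hp (by rw [List.length_ofFn]; exact hlt)
    (fun w _ => ?_) _ (List.mem_ofFn.2 ⟨a, rfl⟩)
  rw [rel_iterate, hπ, hθp]
  rcases w with i | m <;> rfl

end RigidPrime

section BlindPrime

variable {R : GateDAG ι Λ}

/-- `val_eq_of_fixed` for fan-in `< p` and input maps of order dividing the prime `p`. [folklore] -/
theorem val_eq_of_fixed_prime [DecidableEq ι] [DecidableEq Λ] (hR : R.IsRigidDAG) {p : ℕ}
    (hp : p.Prime) (hlt : ∀ l, (R.fn l).1 < p) {P : Set (ι → ι)} (hP : ∀ π ∈ P, π^[p] = _root_.id)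
    (θ : ∀ π ∈ P, Λ ≃ Λ) (hθ : ∀ π (hπ : π ∈ P), R.IsAut π (θ π hπ))
    {x y : ι → Bool} (hxy : ∀ i, (∀ π ∈ P, π i = i) → x i = y i) :
    ∀ l, (∀ π (hπ : π ∈ P), θ π hπ l = l) → R.val x l = R.val y l := by
  intro l
  induction l using R.wf.induction with
  | _ l ih =>
    intro hfix
    rw [R.val_eq, R.val_eq]
    refine congrArg (R.fn l).2 (funext fun a => ?_)
    have hchild : ∀ π (hπ : π ∈ P), rel π (θ π hπ) (R.args l a) = R.args l a :=
      fun π hπ => (hθ π hπ).rel_args_eq_of_prime hR hp (hP π hπ) (hfix π hπ) (hlt l) a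
    cases ha : R.args l a with
    | inl i =>
      simp only [wire_inl]
      refine hxy i fun π hπ => ?_
      have := hchild π hπ
      rw [ha] at this
      exact Sum.inl.inj this
    | inr m =>
      simp only [wire_inr]
      refine ih m ⟨a, ha⟩ fun π hπ => ?_
      have := hchild π hπ
      rw [ha] at this
      exact Sum.inr.inj this

/-- `evalOut_eq_of_fixed` for fan-in `< p` and input maps of order dividing the prime `p`.
[folklore] -/
theorem evalOut_eq_of_fixed_prime [DecidableEq ι] [DecidableEq Λ] (hR : R.IsRigidDAG) {p : ℕ}
    (hp : p.Prime) (hlt : ∀ l, (R.fn l).1 < p) {P : Set (ι → ι)} (hP : ∀ π ∈ P, π^[p] = _root_.id)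
    (θ : ∀ π ∈ P, Λ ≃ Λ) (hθ : ∀ π (hπ : π ∈ P), R.IsAut π (θ π hπ))
    {x y : ι → Bool} (hxy : ∀ i, (∀ π ∈ P, π i = i) → x i = y i) :
    R.evalOut x = R.evalOut y := by
  unfold evalOut
  cases ho : R.out with
  | inl i =>
    simp only [wire_inl]
    refine hxy i fun π hπ => ?_
    have := (hθ π hπ).out_eq
    rw [ho] at this
    exact Sum.inl.inj this
  | inr l =>
    simp only [wire_inr]
    refine val_eq_of_fixed_prime hR hp hlt hP θ hθ hxy l fun π hπ => ?_
    have := (hθ π hπ).out_eq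
    rw [ho] at this
    exact Sum.inr.inj this

end BlindPrime

end GateDAG

/-! ### Matrix circuits: fan-in below a prime `p ≤ g` -/

section MatrixPrime

open GateDAG

variable {m : ℕ}

/-- Iterates of the diagonal map. [folklore] -/
theorem diagMap_iterate (ρ : Equiv.Perm (Fin m)) (n : ℕ) : (diagMap ρ)^[n] = diagMap (ρ ^ n) := by
  induction n with
  | zero => funext q; simp [diagMap]
  | succ n ih =>
    funext q
    rw [Function.iterate_succ_apply', ih]
    simp [diagMap, pow_succ']

/-- **Symmetric circuits of fan-in `< p` see only the positions fixed by the budget elements of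
order dividing `p`** (`p` prime). [folklore] -/
theorem Circuit.eval_eq_of_fanIn_lt_prime {g p : ℕ} (hp : p.Prime) (C : Circuit (Fin m × Fin m))
    (hlt : ∀ gt ∈ C.gates, gt.arity < p) (hsym : ∀ gt ∈ C.gates, gt.fn.IsSymmetric)
    (hS : C.IsSymmetricUnder (pointStabiliserBudget m g)) {x y : Fin m × Fin m → Bool}
    (hxy : ∀ u v : Fin m,
      (∀ ρ ∈ pointStabiliserBudget m g, ρ ^ p = 1 → ρ u = u ∧ ρ v = v) → x (u, v) = y (u, v)) :
    C.eval x = C.eval y := by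
  classical
  let D := GateDAG.ofCircuit C
  have hfs : ∀ l, (D.fn l).IsSymmetric := fun l => hsym _ (List.getElem_mem _)
  have hDs : D.IsSymm (GateDAG.diagMaps (pointStabiliserBudget m g)) :=
    (GateDAG.isSymmetricUnder_iff_ofCircuit C _).1 hS
  let R := D.reduce
  have hR : R.IsRigidDAG := D.isRigidDAG_reduce
  have hp2 : 2 ≤ p := hp.two_le
  have hRlt : ∀ l, (R.fn l).1 < p := by
    rintro (q | c)
    · show (D.fn q.out.1).1 < p
      exact hlt _ (List.getElem_mem _)
    · show 1 < p
      omega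
  have hdiag : ∀ ρ : Equiv.Perm (Fin m),
      (⇑(Equiv.prodCongr ρ ρ) : Fin m × Fin m → Fin m × Fin m) = diagMap ρ :=
    fun ρ => funext fun q => rfl
  have hAut : ∀ ρ ∈ pointStabiliserBudget m g, ∃ θ : D.RGate ≃ D.RGate, R.IsAut (diagMap ρ) θ := by
    intro ρ hρ
    obtain ⟨θ, hθ⟩ := hDs _ (GateDAG.diag_mem_diagMaps hρ)
    have hθ' : D.IsAut (⇑(Equiv.prodCongr ρ ρ)) θ := by rw [hdiag]; exact hθ
    exact ⟨_, by have := hθ'.reduce; rwa [hdiag] at this⟩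
  let P : Set (Fin m × Fin m → Fin m × Fin m) :=
    {π | ∃ ρ ∈ pointStabiliserBudget m g, ρ ^ p = 1 ∧ π = diagMap ρ}
  have hP : ∀ π ∈ P, π^[p] = _root_.id := by
    rintro π ⟨ρ, -, hρp, rfl⟩
    rw [diagMap_iterate, hρp]
    funext q; simp [diagMap]
  have hPaut : ∀ π ∈ P, ∃ θ : D.RGate ≃ D.RGate, R.IsAut π θ := by
    rintro π ⟨ρ, hρ, -, rfl⟩
    exact hAut ρ hρ
  choose θ hθ using hPaut
  have hxy' : ∀ i : Fin m × Fin m, (∀ π ∈ P, π i = i) → x i = y i := by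
    rintro ⟨u, v⟩ hi
    refine hxy u v fun ρ hρ hρp => ?_
    have := hi (diagMap ρ) ⟨ρ, hρ, hρp, rfl⟩
    simp only [diagMap, Prod.mk.injEq] at this
    exact this
  have key := GateDAG.evalOut_eq_of_fixed_prime hR hp hRlt hP θ hθ hxy'
  rw [← GateDAG.evalOut_ofCircuit C x, ← GateDAG.evalOut_ofCircuit C y,
    ← GateDAG.evalOut_reduce _ hfs x, ← GateDAG.evalOut_reduce _ hfs y]
  exact key

/-- **Every free vertex lies on a `p`-cycle of free vertices** (`p ≤ g ≤ m`, `2 ≤ p`): an element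
of the budget of order dividing `p` moving it. [folklore] -/
theorem exists_cycle_moving {g p : ℕ} (hp : 2 ≤ p) (hpg : p ≤ g) (hgm : g ≤ m) {u : Fin m}
    (hu : m ≤ (u : ℕ) + g) :
    ∃ ρ ∈ pointStabiliserBudget m g, ρ ^ p = 1 ∧ ρ u ≠ u := by
  classical
  -- a duplicate-free list of `p` free vertices containing `u`
  obtain ⟨l, hnd, hlen, hul, hfree⟩ : ∃ l : List (Fin m), l.Nodup ∧ l.length = p ∧ u ∈ l ∧
      ∀ v ∈ l, m ≤ (v : ℕ) + g := by
    by_cases hcase : m ≤ (u : ℕ) + p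
    · -- `u` is among the last `p` vertices
      refine ⟨List.ofFn fun j : Fin p => (⟨m - 1 - j, by omega⟩ : Fin m), ?_, by simp, ?_, ?_⟩
      · rw [List.nodup_ofFn]
        intro j j' h
        simp only [Fin.mk.injEq] at h
        exact Fin.ext (by omega)
      · rw [List.mem_ofFn]
        refine ⟨⟨m - 1 - u, by omega⟩, Fin.ext ?_⟩
        show m - 1 - (m - 1 - (u : ℕ)) = u
        omega
      · intro v hv
        rw [List.mem_ofFn] at hv
        obtain ⟨j, rfl⟩ := hv
        show m ≤ m - 1 - j + g
        omega
    · -- `u` is free but below the last `p` vertices: `u` followed by the last `p - 1` vertices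
      refine ⟨u :: List.ofFn fun j : Fin (p - 1) => (⟨m - 1 - j, by omega⟩ : Fin m), ?_, ?_,
        List.mem_cons_self, ?_⟩
      · rw [List.nodup_cons, List.mem_ofFn, List.nodup_ofFn]
        refine ⟨?_, fun j j' h => ?_⟩
        · rintro ⟨j, hj⟩
          have := congrArg Fin.val hj
          simp only at this
          omega
        · simp only [Fin.mk.injEq] at h
          exact Fin.ext (by omega)
      · rw [List.length_cons, List.length_ofFn]; omega
      · intro v hv
        rw [List.mem_cons, List.mem_ofFn] at hv
        rcases hv with rfl | ⟨j, rfl⟩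
        · exact hu
        · show m ≤ m - 1 - j + g
          omega
  refine ⟨l.formPerm, ?_, ?_, ?_⟩
  · rw [mem_pointStabiliserBudget_iff]
    intro i hi
    exact List.formPerm_apply_of_notMem fun him => by have := hfree i him; omega
  · rw [← hlen]
    exact List.formPerm_pow_length_eq_one_of_nodup l hnd
  · rw [List.formPerm_apply_mem_ne_self_iff l hnd u hul, hlen]
    exact hp

/-- **Symmetric circuits of fan-in `< p` are blind to the free vertices** (`p` prime,
`p ≤ g ≤ m`): two matrices agreeing on the ordered block get the same value. In particular
(Bertrand) fan-in `≤ g / 2` suffices. [folklore] -/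
theorem Circuit.eval_eq_of_fanIn_lt_prime_of_agree {g p : ℕ} (hp : p.Prime) (hpg : p ≤ g)
    (hgm : g ≤ m) (C : Circuit (Fin m × Fin m))
    (hlt : ∀ gt ∈ C.gates, gt.arity < p) (hsym : ∀ gt ∈ C.gates, gt.fn.IsSymmetric)
    (hS : C.IsSymmetricUnder (pointStabiliserBudget m g)) {x y : Fin m × Fin m → Bool}
    (hxy : ∀ u v : Fin m, (u : ℕ) + g < m → (v : ℕ) + g < m → x (u, v) = y (u, v)) :
    C.eval x = C.eval y := by
  refine C.eval_eq_of_fanIn_lt_prime hp hlt hsym hS fun u v huv => hxy u v ?_ ?_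
  · by_contra hu
    obtain ⟨ρ, hρ, h3, hne⟩ := exists_cycle_moving hp.two_le hpg hgm (u := u) (by omega)
    exact hne (huv ρ hρ h3).1
  · by_contra hv
    obtain ⟨ρ, hρ, h3, hne⟩ := exists_cycle_moving hp.two_le hpg hgm (u := v) (by omega)
    exact hne (huv ρ hρ h3).2

open scoped Classical in
/-- **A symmetric circuit for Hamiltonicity needs a gate of fan-in `≥ p` for every prime
`p ≤ g`** (`g ≤ m`, `3 ≤ g`): with all fan-ins below a prime `p ≤ g` the circuit is blind to the
free vertices. [folklore] -/
theorem Circuit.exists_gate_arity_ge_prime_of_computes_ham {g p : ℕ} (hp : p.Prime) (hpg : p ≤ g)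
    (hg : 3 ≤ g) (hgm : g ≤ m) (C : Circuit (Fin m × Fin m))
    (hsym : ∀ gt ∈ C.gates, gt.fn.IsSymmetric) (hS : C.IsSymmetricUnder (pointStabiliserBudget m g))
    (hC : C.Computes (fun x : Fin m × Fin m → Bool =>
        decide (SimpleGraph.fromRel fun u v => x (u, v) = true : SimpleGraph (Fin m)).IsHamiltonian)) :
    ∃ gt ∈ C.gates, p ≤ gt.arity := by
  by_contra hno
  push Not at hno
  have hm : 3 ≤ m := hg.trans hgm
  let w : Fin m := ⟨m - 1, by omega⟩
  have hagree : ∀ u v : Fin m, (u : ℕ) + g < m → (v : ℕ) + g < m →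
      true = isolateMat w (u, v) := by
    intro u v hu hv
    have huw : u ≠ w := fun h => by rw [h] at hu; change m - 1 + g < m at hu; omega
    have hvw : v ≠ w := fun h => by rw [h] at hv; change m - 1 + g < m at hv; omega
    simp [isolateMat, huw, hvw]
  have key := C.eval_eq_of_fanIn_lt_prime_of_agree hp hpg hgm hno hsym hS
    (x := fun _ => true) (y := isolateMat w) hagree
  rw [hC, hC] at key
  rw [Bool.eq_iff_iff, decide_eq_true_iff, decide_eq_true_iff] at key
  exact not_isHamiltonian_isolateMat hm w (key.1 (isHamiltonian_fromRel_true hm))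

open scoped Classical in
/-- **At the window, a symmetric threshold circuit for `HAM_m` has a gate of fan-in more than
`⌊log₂ m⌋ / 2`** (`m ≥ 8`; Bertrand's postulate supplies a prime in `(⌊log₂ m⌋/2, ⌊log₂ m⌋]`).
[folklore] -/
theorem Circuit.exists_gate_arity_gt_half_log_of_computes_ham (hm : 8 ≤ m)
    (C : Circuit (Fin m × Fin m)) (hB : C.IsOver tcBasis)
    (hS : C.IsSymmetricUnder (pointStabiliserBudget m (Nat.log 2 m)))
    (hC : C.Computes (fun x : Fin m × Fin m → Bool =>
        decide (SimpleGraph.fromRel fun u v => x (u, v) = true : SimpleGraph (Fin m)).IsHamiltonian)) :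
    ∃ gt ∈ C.gates, Nat.log 2 m / 2 < gt.arity := by
  have hg : 3 ≤ Nat.log 2 m := Nat.le_log_of_pow_le (by norm_num) hm
  have hgm : Nat.log 2 m ≤ m := (Nat.log_lt_self 2 (by omega)).le
  obtain ⟨p, hp, hlp, hple⟩ := Nat.exists_prime_lt_and_le_two_mul (Nat.log 2 m / 2) (by omega)
  have hpg : p ≤ Nat.log 2 m := by omega
  obtain ⟨gt, hgt, hge⟩ := C.exists_gate_arity_ge_prime_of_computes_ham hp hpg hg hgm
    (fun gt hgt => isSymmetric_of_mem_tcBasis (hB gt hgt)) hS hC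
  exact ⟨gt, hgt, by omega⟩

end MatrixPrime

end Literature.Computability.Complexity
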